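import Mathlib
import Literature.NumberTheory.LFunctions.WeilExplicit
import Literature.NumberTheory.LFunctions.WeilExplicitProofs
import Literature.NumberTheory.LFunctions.WeilGroundEnergyProofs
import Literature.NumberTheory.LFunctions.WeilGroundState
import Literature.NumberTheory.LFunctions.WeilGroundStateRealZerosProofs
import HarnessLib

/-!
# The weak Euler–Lagrange equation of an operator-free Weil ground state
(crux item stmt-RiemannHypothesis-1527 `GroundStatesConvergeToXi`, route
route-RiemannHypothesis-WeilGroundState, line `Sketch`; `--supports`, RH-free groundwork for
the load-bearing stub `stub_tightWeakLimit`)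

A ground state of Weil's truncated quadratic form on the window `[-a, a]` is encoded in the tree
WITHOUT an operator (`IsWeilGroundState a u`): `u ∈ L²` is the `L²`-limit of an `L²`-normalised
minimising sequence `gₙ` of window test functions, `Re Q(gₙ) → ε(a)`.  Every position-space
attack on the crux (the closure lemma "tight weak limits of renormalised ground states are
Weil-harmonic" of card `harmonic-weak-limit-closure`, the Doob flattening of card
`xi-kernel-doob-transform`, width/moment laws) starts from the first-order condition of
minimality.  This file proves it in the only form the encoding allows, Bombieri's variational
equation (Bombieri 2000, §4 Lemma 1 / (4.2) `λ f = L[f]`) in WEAK form ALONG THE MINIMISING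
SEQUENCE:

* `groundState_eulerLagrange` — for every window test function `h`,
  `W(gₙ ⋆ h̃) → ε(a) · ⟨u, h⟩ = ε(a) ∫ u h̄`.

No closability of the form and no self-adjoint operator are needed: the shifted form
`q = Re Q − ε(a)‖·‖²` is non-negative on window test functions, so its polar form obeys
Cauchy–Schwarz `|q(gₙ + h) − q(gₙ) − q(h)| ≤ 2 √q(gₙ) √q(h)` (`ConnesVanSuijlekom.abs_polar_le`,
in the tree) and `q(gₙ) → 0`; the polar defect is `2 Re W(gₙ ⋆ h̃) − 2 ε(a) Re ⟨gₙ, h⟩` by the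
HERMITIAN SYMMETRY `W(h ⋆ g̃) = conj W(g ⋆ h̃)`, proved here hypothesis-free from
`conj W(k) = W(k̃)` (`conj_weilFunctional_eq_weilReflect`) and `(g ⋆ h̃)~ = h ⋆ g̃`
(`weilReflect_weilConv_weilReflect`); the imaginary part follows from `h ↦ i h`, and
`⟨gₙ, h⟩ → ⟨u, h⟩` in `L²`.

References: E. Bombieri, Rend. Lincei (9) 11 (2000), §4 (Problem 2, Lemma 1, (4.2), Thm 3);
A. Connes, W. D. van Suijlekom, Comm. Math. Phys. 406 (2025) = arXiv:2511.23257, proof of Thm 6.1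
(first display); Yoshida 1992 §2 (the form is hermitian).
-/

noncomputable section

set_option linter.dupNamespace false

open scoped Topology Real ComplexConjugate
open Filter Set MeasureTheory Complex

namespace Summit.RiemannHypothesis.RiemannHypothesis.Theorems.GroundStatesConvergeToXi

open Literature.NumberTheory.LFunctions

/-! ### Hermitian symmetry of the polarised Weil functional (hypothesis-free) -/

/-- **Reflection of a polarised kernel**: `(g ⋆ h̃)~ = h ⋆ g̃` for all `g h : ℝ → ℂ`
(`(g ⋆ h̃)~(t) = conj ∫ g(u) conj h(t+u) du = ∫ h(u+t) conj g(u) du`, substitution `u ↦ u + t`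
in `(h ⋆ g̃)(t) = ∫ h(u) conj g(u − t) du`).  No hypotheses: conjugation and translation commute
with the Bochner integral unconditionally. -/
theorem weilReflect_weilConv_weilReflect (g h : ℝ → ℂ) :
    weilReflect (weilConv g (weilReflect h)) = weilConv h (weilReflect g) := by
  funext t
  change conj (weilConv g (weilReflect h) (-t)) = weilConv h (weilReflect g) t
  rw [weilConv_apply, weilConv_apply, ← integral_conj,
    ← integral_add_right_eq_self (fun u : ℝ => h u * weilReflect g (t - u)) t]
  refine integral_congr_ae (Eventually.of_forall fun u => ?_)
  have h1 : -(-t - u) = u + t := by ring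
  have h2 : -(t - (u + t)) = u := by ring
  simp only [weilReflect, map_mul, Complex.conj_conj, h1, h2]
  exact mul_comm _ _

/-- **`conj W(k) = W(k̃)` for every `k : ℝ → ℂ`** (no hypotheses).  Term by term, with
`(k̃)^(s) = conj k̂(1 − conj s)` (`weilMellin_weilReflect_holds`): the polar term of `k̃` is
`conj k̂(1) + conj k̂(0)`; the prime term has summands `Λ(n) n^{-1/2}(conj k(−log n) + conj k(log n))`;
the archimedean integrand of `k̃` at `1/2 + it` is `conj k̂(1/2 + it) · Re ψ(1/4 + it/2)` and
`k̃(0) = conj k(0)`.  (For self-adjoint `k` this is `conj_weilFunctional_of_selfAdjoint`.) -/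
theorem conj_weilFunctional_eq_weilReflect (k : ℝ → ℂ) :
    conj (weilFunctional k) = weilFunctional (weilReflect k) := by
  have hM : ∀ s : ℂ, weilMellin (weilReflect k) s = conj (weilMellin k (1 - conj s)) :=
    fun s => weilMellin_weilReflect_holds k s
  have h0 : weilReflect k 0 = conj (k 0) := by simp [weilReflect]
  have hP : conj (weilPolarTerm k) = weilPolarTerm (weilReflect k) := by
    rw [weilPolarTerm, weilPolarTerm, map_add, hM, hM, map_zero, map_one, sub_zero, sub_self,
      add_comm]
  have hΛ : conj (weilPrimeTerm k) = weilPrimeTerm (weilReflect k) := by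
    rw [weilPrimeTerm, weilPrimeTerm, Complex.conj_tsum]
    refine tsum_congr fun n => ?_
    rw [map_mul, map_div₀, Complex.conj_ofReal, Complex.conj_ofReal, map_add]
    simp only [weilReflect, neg_neg]
    ring
  have hA : conj (weilArchTerm k) = weilArchTerm (weilReflect k) := by
    rw [weilArchTerm, weilArchTerm, map_sub, map_mul, map_mul, h0, Complex.conj_ofReal,
      weilArchIntegral, weilArchIntegral, ← integral_conj]
    congr 2
    · rw [map_div₀, map_one, map_mul, map_ofNat, Complex.conj_ofReal]
    · refine integral_congr_ae (Eventually.of_forall fun t => ?_)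
      dsimp only
      rw [map_mul, Complex.conj_ofReal, hM]
      congr 3
      rw [map_add, map_mul, Complex.conj_ofReal, Complex.conj_I, map_div₀, map_one, map_ofNat]
      ring
  rw [weilFunctional, weilFunctional, map_add, map_sub, hP, hΛ, hA]

/-- **Hermitian symmetry of the polarised Weil functional**: `W(h ⋆ g̃) = conj W(g ⋆ h̃)` for
all `g h : ℝ → ℂ` (Bombieri 2000 §§2–3 / Yoshida 1992 §2: `T[f * ḡ*]` is a hermitian form);
no hypotheses. -/
theorem weilFunctional_weilConv_weilReflect_swap (g h : ℝ → ℂ) :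
    weilFunctional (weilConv h (weilReflect g)) =
      conj (weilFunctional (weilConv g (weilReflect h))) := by
  rw [conj_weilFunctional_eq_weilReflect, weilReflect_weilConv_weilReflect]

/-! ### Scalars through `⋆`, `̃`, `W` (the factor `i` of the polarisation) -/

/-- `(i h)~ = −i · h̃`. -/
theorem weilReflect_I_mul (h : ℝ → ℂ) :
    weilReflect (fun t => I * h t) = fun t => -I * weilReflect h t := by
  funext t
  simp [weilReflect, Complex.conj_I]

/-- `g ⋆ (c k) = c (g ⋆ k)` (no hypotheses). -/
theorem weilConv_const_mul_right' (c : ℂ) (g k : ℝ → ℂ) :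
    weilConv g (fun t => c * k t) = fun t => c * weilConv g k t := by
  funext t
  rw [weilConv_apply, weilConv_apply, ← integral_const_mul]
  congr 1 with u
  ring

/-- `W(g ⋆ (i h)~) = −i · W(g ⋆ h̃)`. -/
theorem weilFunctional_weilConv_weilReflect_I_mul (g h : ℝ → ℂ) :
    weilFunctional (weilConv g (weilReflect fun t => I * h t)) =
      -I * weilFunctional (weilConv g (weilReflect h)) := by
  rw [weilReflect_I_mul, weilConv_const_mul_right', weilFunctional_const_mul]

/-- `⟨g, i h⟩ = −i ⟨g, h⟩`: `∫ g · conj (i h) = −i ∫ g h̄`. -/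
theorem integral_mul_conj_I_mul (g h : ℝ → ℂ) :
    ∫ t, g t * conj (I * h t) = -I * ∫ t, g t * conj (h t) := by
  rw [← integral_const_mul]
  congr 1 with t
  simp only [map_mul, Complex.conj_I]
  ring

/-! ### The weak Euler–Lagrange equation along a minimising sequence -/

/-- **The real polar defect vanishes in the limit.**  Let `gₙ` be `L²`-normalised window test
functions with `Re Q(gₙ) → ε(a)`.  Then for every window test function `k`,
`Re(W(gₙ ⋆ k̃) + W(k ⋆ g̃ₙ)) − 2 ε(a) Re ∫ gₙ k̄ → 0`: this quantity is the polar form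
`q(gₙ + k) − q(gₙ) − q(k)` of the non-negative shifted form `q = Re Q − ε(a)‖·‖²`
(`ConnesVanSuijlekom.re_weilQuadratic_add_real_mul`, `integral_norm_sq_add_real_mul`), bounded by
`2 √q(gₙ) √q(k)` (`ConnesVanSuijlekom.abs_polar_le`), and `q(gₙ) = Re Q(gₙ) − ε(a) → 0`. -/
theorem tendsto_polarDefect_of_minimizingSeq {a : ℝ} {g : ℕ → ℝ → ℂ}
    (hg : ∀ n, IsWeilTest (g n) ∧ tsupport (g n) ⊆ Icc (-a) a ∧ ∫ t, ‖g n t‖ ^ 2 = (1 : ℝ))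
    (hQ : Tendsto (fun n => (weilQuadratic (g n)).re) atTop (𝓝 (weilGroundEnergy a)))
    {k : ℝ → ℂ} (hk : IsWeilTest k) (hks : tsupport k ⊆ Icc (-a) a) :
    Tendsto (fun n => (weilFunctional (weilConv (g n) (weilReflect k)) +
        weilFunctional (weilConv k (weilReflect (g n)))).re -
      2 * weilGroundEnergy a * (∫ t, g n t * conj (k t)).re) atTop (𝓝 0) := by
  set ε := weilGroundEnergy a with hε
  -- `q(gₙ) → 0`
  have hq : Tendsto (fun n => (weilQuadratic (g n)).re - ε * ∫ t, ‖g n t‖ ^ 2) atTop (𝓝 0) := by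
    have hfun : (fun n => (weilQuadratic (g n)).re - ε * ∫ t, ‖g n t‖ ^ 2) =
        fun n => (weilQuadratic (g n)).re - ε := by
      funext n
      rw [(hg n).2.2, mul_one]
    rw [hfun]
    have := hQ.sub_const ε
    rwa [sub_self] at this
  set qk : ℝ := (weilQuadratic k).re - ε * ∫ t, ‖k t‖ ^ 2 with hqk
  -- the Cauchy–Schwarz bound on the polar defect
  have hbound : ∀ n, |(weilFunctional (weilConv (g n) (weilReflect k)) +
        weilFunctional (weilConv k (weilReflect (g n)))).re -
      2 * ε * (∫ t, g n t * conj (k t)).re| ≤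
      2 * Real.sqrt ((weilQuadratic (g n)).re - ε * ∫ t, ‖g n t‖ ^ 2) * Real.sqrt qk := by
    intro n
    have hcs := ConnesVanSuijlekom.abs_polar_le (hg n).1 (hg n).2.1 hk hks
    have e1 := ConnesVanSuijlekom.re_weilQuadratic_add_real_mul (hg n).1 hk 1
    have e2 := ConnesVanSuijlekom.integral_norm_sq_add_real_mul (hg n).1 hk 1
    have hone : (g n + fun x => ((1 : ℝ) : ℂ) * k x) = g n + k := by
      funext x
      simp
    rw [hone] at e1 e2
    have key : ((weilQuadratic (g n + k)).re - ε * ∫ x, ‖(g n + k) x‖ ^ 2) -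
        ((weilQuadratic (g n)).re - ε * ∫ x, ‖g n x‖ ^ 2) -
        ((weilQuadratic k).re - ε * ∫ x, ‖k x‖ ^ 2) =
        (weilFunctional (weilConv (g n) (weilReflect k)) +
            weilFunctional (weilConv k (weilReflect (g n)))).re -
          2 * ε * (∫ t, g n t * conj (k t)).re := by
      rw [e1, e2]
      ring
    rw [← key]
    exact hcs
  -- squeeze
  have hsq : Tendsto (fun n => 2 * Real.sqrt ((weilQuadratic (g n)).re - ε * ∫ t, ‖g n t‖ ^ 2) *
      Real.sqrt qk) atTop (𝓝 0) := by
    have := (hq.sqrt.const_mul 2).mul_const (Real.sqrt qk)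
    simpa using this
  exact squeeze_zero_norm (fun n => by rw [Real.norm_eq_abs]; exact hbound n) hsq

/-- **Weak Euler–Lagrange equation of an operator-free ground state** (Bombieri 2000, §4
Lemma 1 / (4.2), in weak form along the minimising sequence).  Let `gₙ` be `L²`-normalised test
functions on the window `[-a, a]` with `Re Q(gₙ) → ε(a)` converging in `L²` to `u ∈ L²` (so
`IsWeilGroundState a u` with data `gₙ`).  Then for every test function `h` supported in the
window, `W(gₙ ⋆ h̃) → ε(a) · ∫ u h̄`: the polarised Weil functional against `h` converges to
`ε(a)` times the `L²`-pairing `⟨u, h⟩`.  Proof: the real polar defect tends to `0`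
(`tendsto_polarDefect_of_minimizingSeq`) and equals `2 Re W(gₙ ⋆ h̃) − 2ε(a) Re⟨gₙ, h⟩` by
hermitian symmetry; replacing `h` by `i h` gives the imaginary parts; finally
`⟨gₙ, h⟩ → ⟨u, h⟩` (`ConnesVanSuijlekom.tendsto_integral_mul_conj`). -/
theorem groundState_eulerLagrange {a : ℝ} {u : ℝ → ℂ} {g : ℕ → ℝ → ℂ}
    (hg : ∀ n, IsWeilTest (g n) ∧ tsupport (g n) ⊆ Icc (-a) a ∧ ∫ t, ‖g n t‖ ^ 2 = (1 : ℝ))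
    (hQ : Tendsto (fun n => (weilQuadratic (g n)).re) atTop (𝓝 (weilGroundEnergy a)))
    (hu : MemLp u 2) (hL : Tendsto (fun n => ∫ t, ‖g n t - u t‖ ^ 2) atTop (𝓝 0))
    {h : ℝ → ℂ} (hh : IsWeilTest h) (hhs : tsupport h ⊆ Icc (-a) a) :
    Tendsto (fun n => weilFunctional (weilConv (g n) (weilReflect h))) atTop
      (𝓝 ((weilGroundEnergy a : ℂ) * ∫ t, u t * conj (h t))) := by
  set ε := weilGroundEnergy a with hε
  -- notation: `A n = W(gₙ ⋆ h̃)`, `P n = ⟨gₙ, h⟩`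
  set A : ℕ → ℂ := fun n => weilFunctional (weilConv (g n) (weilReflect h)) with hA
  set P : ℕ → ℂ := fun n => ∫ t, g n t * conj (h t) with hP
  -- real parts: `Re A n − ε Re P n → 0`
  have hre : Tendsto (fun n => (A n).re - ε * (P n).re) atTop (𝓝 0) := by
    have h1 := tendsto_polarDefect_of_minimizingSeq hg hQ hh hhs
    have hfun : (fun n => (weilFunctional (weilConv (g n) (weilReflect h)) +
        weilFunctional (weilConv h (weilReflect (g n)))).re -
        2 * weilGroundEnergy a * (∫ t, g n t * conj (h t)).re) =
        fun n => 2 * ((A n).re - ε * (P n).re) := by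
      funext n
      rw [weilFunctional_weilConv_weilReflect_swap (g n) h]
      simp only [hA, hP, Complex.add_re, Complex.conj_re]
      ring
    rw [hfun] at h1
    have h2 := h1.const_mul (1 / 2 : ℝ)
    simpa using h2
  -- imaginary parts: `Im A n − ε Im P n → 0`, from the test function `i h`
  have him : Tendsto (fun n => (A n).im - ε * (P n).im) atTop (𝓝 0) := by
    have hIh : IsWeilTest fun t => I * h t := hh.const_mul I
    have hIhs : tsupport (fun t => I * h t) ⊆ Icc (-a) a := tsupport_mul_subset_right.trans hhs
    have h1 := tendsto_polarDefect_of_minimizingSeq hg hQ hIh hIhs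
    have hfun : (fun n => (weilFunctional (weilConv (g n) (weilReflect fun t => I * h t)) +
        weilFunctional (weilConv (fun t => I * h t) (weilReflect (g n)))).re -
        2 * weilGroundEnergy a * (∫ t, g n t * conj (I * h t)).re) =
        fun n => 2 * ((A n).im - ε * (P n).im) := by
      funext n
      rw [weilFunctional_weilConv_weilReflect_swap (g n) (fun t => I * h t),
        weilFunctional_weilConv_weilReflect_I_mul, integral_mul_conj_I_mul]
      simp only [hA, hP, Complex.add_re, Complex.conj_re, Complex.mul_re, Complex.neg_re,
        Complex.neg_im, Complex.I_re, Complex.I_im]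
      ring
    rw [hfun] at h1
    have h2 := h1.const_mul (1 / 2 : ℝ)
    simpa using h2
  -- hence `A n − ε P n → 0` in `ℂ`
  have hD : Tendsto (fun n => A n - (ε : ℂ) * P n) atTop (𝓝 0) := by
    refine squeeze_zero_norm (fun n => Complex.norm_le_abs_re_add_abs_im _) ?_
    have h3 := hre.abs.add him.abs
    simp only [abs_zero, add_zero] at h3
    refine h3.congr fun n => ?_
    simp only [Complex.sub_re, Complex.sub_im, Complex.re_ofReal_mul, Complex.im_ofReal_mul]
  -- and `P n → ⟨u, h⟩`
  have hPlim : Tendsto P atTop (𝓝 (∫ t, u t * conj (h t))) := by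
    have h4 := ConnesVanSuijlekom.tendsto_integral_mul_conj (ConnesVanSuijlekom.isWeilTest_memLp hh)
      hu (fun m => ConnesVanSuijlekom.isWeilTest_memLp (hg m).1) hL
    have h5 := (Complex.continuous_conj.tendsto _).comp h4
    have hconj : ∀ v : ℝ → ℂ, conj (∫ t, h t * conj (v t)) = ∫ t, v t * conj (h t) := by
      intro v
      rw [← integral_conj]
      congr 1 with t
      simp only [map_mul, Complex.conj_conj]
      exact mul_comm _ _
    have h6 : (fun m => conj (∫ t, h t * conj (g m t))) = P := by
      funext m
      exact hconj (g m)
    rw [Function.comp_def, h6, hconj u] at h5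
    exact h5
  -- conclude
  have hsum := hD.add (hPlim.const_mul (ε : ℂ))
  rw [zero_add] at hsum
  refine hsum.congr fun n => ?_
  simp only [hA, hP]
  ring

/-- **Weak Euler–Lagrange equation, `IsWeilGroundState` form.**  Every operator-free ground
state `u` at window `a` comes with a normalised minimising sequence `gₙ → u` in `L²` along which
`W(gₙ ⋆ h̃) → ε(a) ∫ u h̄` for every window test function `h`. -/
theorem _root_.Literature.NumberTheory.LFunctions.IsWeilGroundState.exists_eulerLagrange
    {a : ℝ} {u : ℝ → ℂ} (hu : IsWeilGroundState a u) :
    ∃ g : ℕ → ℝ → ℂ,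
      (∀ n, IsWeilTest (g n) ∧ tsupport (g n) ⊆ Icc (-a) a ∧ ∫ t, ‖g n t‖ ^ 2 = (1 : ℝ)) ∧
      Tendsto (fun n => (weilQuadratic (g n)).re) atTop (𝓝 (weilGroundEnergy a)) ∧
      Tendsto (fun n => ∫ t, ‖g n t - u t‖ ^ 2) atTop (𝓝 0) ∧
      ∀ h : ℝ → ℂ, IsWeilTest h → tsupport h ⊆ Icc (-a) a →
        Tendsto (fun n => weilFunctional (weilConv (g n) (weilReflect h))) atTop
          (𝓝 ((weilGroundEnergy a : ℂ) * ∫ t, u t * conj (h t))) := by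
  obtain ⟨hu2, g, hg, hQ, hL⟩ := hu
  exact ⟨g, hg, hQ, hL, fun h hh hhs => groundState_eulerLagrange hg hQ hu2 hL hh hhs⟩

end Summit.RiemannHypothesis.RiemannHypothesis.Theorems.GroundStatesConvergeToXi

end
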